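import Literature.MathematicalPhysics.QuantumFieldTheory.Balaban1983to89.B9Thm310WholeDir

/-!
# `Balaban1983to89.B9RWSums346SecondDiffDir` — the second-order L² members (3.46) of Theorem 3.10's sum G(U), per direction pair, OVER THE DIRECTION LETTERS (R1′-A): n06-k's `B9RWSums346SecondDiff` G-side faces with `Identities310₂`

T. Bałaban, *Propagators for lattice gauge theories in a background field*, Commun. Math. Phys. **99** (1985) 389–434
[`Balaban1985BackgroundPropagators`, "B9"], Thm 3.10 (3.105)–(3.108) pp. 414–416, (3.43)–(3.46) p. 398, (3.42) p. 397, Cor. 3.6 p. 408; T. Bałaban,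
*Propagators and renormalization transformations for lattice gauge theories. II*, Commun. Math. Phys. **96** (1984) 223–250 [`Balaban1984PropagatorsII`, "[4]"],
(2.52)–(2.55) p. 232, Lemma 2.1 p. 234.

statement-level skeleton of published theorems with citation tags; proofs where landed; nothing here is a claim about the
Yang–Mills mass gap

WHY THIS FILE (cell `pub-ymgap`, Track A node N06 [B9], row 19; seat `pub-ymgap-dag-n06-c` g10, LOCATED-9 bus l.32219, R1′-A).  The G-side member faces of
the lineage take `hi : Identities310`; over the direction letters they take `hi : Identities310₂ 𝔬 𝔡 𝔩 R H U` (`B9Thm310WholeDir`) — a TYPE-ONLY re-thread: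
every proof reads `hi` through `inv ∕ invT ∕ eq3105 ∕ eq3105T` only, which `Identities310₂` keeps verbatim.  v1 private helpers are copied (private there);
statements, constants and every other hypothesis VERBATIM.

HONEST SCOPE.  Majorant bookkeeping over n06-k's landed calculus; legs, factor bounds and (3.105)–(3.106) are HYPOTHESES (schemas); nothing of [B9] asserted;
COUNT-NEUTRAL; N06 NOT discharged; one finite lattice programme — nothing continuum, nothing about OS positivity or the mass gap.
-/

namespace Literature.MathematicalPhysics.QuantumFieldTheory.Balaban1983to89.B9RWSums346SecondDiffDir

open Finset B6RandomWalk B6RandomWalkHom B9Thm37Sum B9Thm34Ext B9Thm37Glue B9Thm37Whole B9Cor38Whole B9Thm310Whole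
open B9RWSums343to347Whole B9RWSums346Schur B9Thm37GlueCor36 B9RWSums343Holder B9RWSums346Lap B9RWSums344Input B9RWSums346Two
open B11SectG B9Thm37AllNorms B9SectDL2Decay B9Ineq347 B9Ineq347AllEntries
open B9RWSums346SecondDiff B9Thm37WholeDir B9Thm310WholeDir

noncomputable section

section Transfer

variable {g : B9.Geometry} [Fintype g.Site] {R : ℝ} {H : Prop} {X Y Z : Type} [Fintype X] [Fintype Y] [Fintype Z]

omit [Fintype X] [Fintype Y] [Fintype Z] in
/-- Algebra of (3.106) read through an operator on the right: G∘D = G₀∘D + G∘(W∘D) from G = G₀ + G·W. [folklore] -/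
private theorem right_split {Y' : Type} {Dst : (Y' → ℝ) →ₗ[ℝ] (X → ℝ)} {G G0 W : Module.End ℝ (X → ℝ)} (h : G = G0 + G * W) :
    G ∘ₗ Dst = G0 ∘ₗ Dst + G ∘ₗ (W ∘ₗ Dst) := by
  conv_lhs => rw [h]
  apply LinearMap.ext
  intro μ
  simp only [LinearMap.comp_apply, LinearMap.add_apply, Module.End.mul_apply]

/-- L² block bounds add. [folklore] -/
private theorem blockBd_add' (blk₁ : X → g.Site) (blk₂ : Z → g.Site) {T₁ T₂ : (X → ℝ) →ₗ[ℝ] (Z → ℝ)}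
    {K₁ K₂ : g.Site → g.Site → ℝ} (h₁ : BlockBd (g := toB6 g R H) blk₁ blk₂ T₁ K₁)
    (h₂ : BlockBd (g := toB6 g R H) blk₁ blk₂ T₂ K₂) :
    BlockBd (g := toB6 g R H) blk₁ blk₂ (T₁ + T₂) (fun a b => K₁ a b + K₂ a b) := by
  rw [blockBd_iff_hasMaj] at h₁ h₂ ⊢
  exact h₁.add h₂

end Transfer

section GSide

variable {g : B9.Geometry} [Fintype g.Site] [DecidableEq g.Site] {R : ℝ} {H : Prop} {B : B9.Backgrounds}
variable {X Y ι A P : Type} [Fintype P]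

/-- ★ **THE SIXTH L² MEMBER OF (3.46) FOR THE SUM G(U) OF (3.107), PER DIRECTION PAIR** — the L² block bound of G∇\*_{U,ν}∇\*_{U,μ}: from
(3.106) read as G∇\*∇\* = G₀∇\*∇\* + G·(R∇\*∇\*) (`fixedPoint_of_388`; no fixed point in the unknown), the head legs summed with N₃, the
sibling's Schur block bound C·L₀·(Lʲη)² of G (`B9RWSums346Schur.blockBd_entry0` from the pin's sup majorant and the symmetry letter), the
factors summed with N_F, and `comp_l2_transfer` at q = 2: ‖1_{Δ(y)}G∇\*_ν∇\*_μμ‖₂ ≦ `secondConst …`·e^{−(1−2α)δd(y,y′)}‖μ‖₂ for supp μ ⊂ Δ(y′),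
provided 2αδ ≦ δ and (1 − 2α)δ ≦ (1 − α₁)δ₁.
[cite: Balaban1985BackgroundPropagators, Thm 3.10 (3.105)–(3.108) pp.414–416 + (3.46) p.398 + p.413; Balaban1984PropagatorsII, (2.52)–(2.55) p.232 + Lemma 2.1 p.234] -/
theorem l2line5_of_local310_dir [Fintype X] [DecidableEq X] [Fintype ι] [Fintype A]
    (𝔬 : Ops310 g B X Y ι A) (𝔡 : DirOps310 𝔬 P) (𝔩 : DirLetters310 𝔬 P) (R : ℝ) (H : Prop) (d d₁ : ℕ) (δ α L₀ δ₁ α₁ ρ N N' NF Cℓ N3 B3 θ3 C : ℝ)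
    (κ : Sizes310) (S3 : ι → Finset g.Site) (U : B.Cfg)
    (hNF : 0 ≤ NF) (hN3 : 0 ≤ N3) (hB3 : 0 ≤ B3) (hθ3 : 0 ≤ θ3) (hM : 1 ≤ g.M) (hC : 0 ≤ C)
    (hα2 : 2 * α * δ ≤ δ) (hα₁δ₁ : 0 ≤ α₁ * δ₁) (hrate : (1 - 2 * α) * δ ≤ (1 - α₁) * δ₁)
    (hs : StaticOK310 𝔬 ρ N N' NF Cℓ κ) (hcnt3 : ∀ a : g.Site, (∑ i, if a ∈ S3 i then (1 : ℝ) else 0) ≤ N3)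
    (h261 : Ineq261 d₁ (toB6 g R H) δ₁ α₁) (hF : Facts347 g R H d δ α L₀) (hi : Identities310₂ 𝔬 𝔡 𝔩 R H U)
    (hL : L2SecondLegs310 𝔬 𝔡 R H S3 B3 δ₁ U) (hFL : FactorsL2Second310 𝔬 𝔡 R H θ3 δ₁ U)
    (h0 : HasMajorant (g := toB6 g R H) 𝔬.blk (𝔬.G U) (fun (a b : g.Site) => C * g.len a ^ 2 * Real.exp (-(δ * g.dist a b))))
    (hsym : IsTransposePair (𝔬.G U) (𝔬.G U)) (ν μ : P) :
    BlockBd (g := toB6 g R H) 𝔬.blk 𝔬.blk (𝔬.G U ∘ₗ (𝔡.Dsd U ν ∘ₗ 𝔡.Dsd U μ))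
      (fun (a b : g.Site) => secondConst d₁ δ₁ α₁ N3 B3 NF θ3 C L₀ * Real.exp (-((1 - 2 * α) * δ * g.dist a b))) := by
  have hMpos : 0 < g.M := lt_of_lt_of_le one_pos hM
  have hMinv : g.M⁻¹ ≤ 1 := inv_le_one_of_one_le₀ hM
  have hMinv0 : 0 ≤ g.M⁻¹ := inv_nonneg.mpr hMpos.le
  have hlen0 : ∀ y : g.Site, 0 ≤ g.len y := fun y => (hs.lenpos y).le
  have htri : Triangle254 (toB6 g R H) := fun a b c => hs.tri a b c
  have hc1 : 0 ≤ B6.c1 d₁ δ₁ α₁ := c1_nonneg d₁ δ₁ α₁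
  have hL₀ : 0 ≤ L₀ := le_trans (le_trans zero_le_one hF.one_le_L) hF.L_le
  have hρ'0 : 0 ≤ (1 - 2 * α) * δ := by nlinarith [hα2]
  have hexp : ∀ a b : g.Site, Real.exp (-(δ₁ * g.dist a b)) ≤ Real.exp (-((1 - 2 * α) * δ * g.dist a b)) := fun a b =>
    Real.exp_le_exp.mpr (neg_le_neg (mul_le_mul_of_nonneg_right (by nlinarith [hrate, hα₁δ₁]) (hs.dnn a b)))
  -- (3.106)
  have hfix : 𝔬.G U = (∑ i, mulOp (𝔬.h i) * 𝔬.Gsq U i * mulOp (𝔬.h i)) + 𝔬.G U * ∑ a, 𝔬.Rf U a :=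
    fixedPoint_of_388 hi.inv hi.eq3105
  have hsumE : (∑ i, mulOp (𝔬.h i) * 𝔬.Gsq U i * mulOp (𝔬.h i)) ∘ₗ (𝔡.Dsd U ν ∘ₗ 𝔡.Dsd U μ) =
      ∑ i, (mulOp (𝔬.h i) * 𝔬.Gsq U i * mulOp (𝔬.h i)) ∘ₗ (𝔡.Dsd U ν ∘ₗ 𝔡.Dsd U μ) := by
    apply LinearMap.ext
    intro f
    simp only [LinearMap.comp_apply, LinearMap.sum_apply]
  -- the factors R_a∇*∇* summed with N_F
  have hsumF : (∑ a, 𝔬.Rf U a) ∘ₗ (𝔡.Dsd U ν ∘ₗ 𝔡.Dsd U μ) = ∑ a, 𝔬.Rf U a ∘ₗ (𝔡.Dsd U ν ∘ₗ 𝔡.Dsd U μ) := by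
    apply LinearMap.ext
    intro f
    simp only [LinearMap.comp_apply, LinearMap.sum_apply]
  have hP : BlockBd (g := toB6 g R H) 𝔬.blk 𝔬.blk ((∑ a, 𝔬.Rf U a) ∘ₗ (𝔡.Dsd U ν ∘ₗ 𝔡.Dsd U μ))
      (fun (y y' : g.Site) => NF * (θ3 * g.M⁻¹) * g.len y ^ (-(2 : ℝ)) * Real.exp (-(δ₁ * g.dist y y'))) := by
    rw [hsumF]
    have h := blockBd_localSum (R := R) (H := H) 𝔬.blk 𝔬.blk (fun a => 𝔬.Rf U a ∘ₗ (𝔡.Dsd U ν ∘ₗ 𝔡.Dsd U μ))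
      (fun a (y : g.Site) => if y ∈ 𝔬.SF a then (1 : ℝ) else 0)
      (fun (y y' : g.Site) => θ3 * g.M⁻¹ * g.len y ^ (-2 : ℝ) * Real.exp (-(δ₁ * g.dist y y'))) NF
      (fun y y' => mul_nonneg (mul_nonneg (mul_nonneg hθ3 hMinv0) (Real.rpow_nonneg (hlen0 y) _)) (Real.exp_nonneg _))
      (fun a => hFL.facDD a ν μ) hs.cntF
    exact h.mono fun y y' => le_of_eq (by ring)
  -- the L² bound of G by the Schur test of the sibling, as a real power
  have hS0 := blockBd_entry0 hF hC hs.symm hs.lenpos 𝔬.blk h0 hsym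
  have hS : BlockBd (g := toB6 g R H) 𝔬.blk 𝔬.blk (𝔬.G U)
      (fun (a b : g.Site) => C * L₀ * g.len a ^ (2 : ℝ) * Real.exp (-((1 - α) * δ * g.dist a b))) :=
    hS0.mono fun a b => by rw [Real.rpow_two]
  have hρ : (1 - α) * δ = α * δ + (1 - 2 * α) * δ := by ring
  have htail := comp_l2_transfer (R := R) (H := H) 𝔬.blk 𝔬.blk 𝔬.blk hF h261 htri hs.symm hs.dnn hs.lenpos (mul_nonneg hC hL₀)
    (mul_nonneg hNF (mul_nonneg hθ3 hMinv0)) hρ hρ'0 hrate (by rw [abs_two]; norm_num) hS hP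
  have hhead := blockBd_localSum (R := R) (H := H) 𝔬.blk 𝔬.blk
    (fun i => (mulOp (𝔬.h i) * 𝔬.Gsq U i * mulOp (𝔬.h i)) ∘ₗ (𝔡.Dsd U ν ∘ₗ 𝔡.Dsd U μ))
    (fun i (a : g.Site) => if a ∈ S3 i then (1 : ℝ) else 0) (fun (a b : g.Site) => B3 * Real.exp (-(δ₁ * g.dist a b))) N3
    (fun a b => mul_nonneg hB3 (Real.exp_nonneg _)) (fun i => hL.l5 i ν μ) hcnt3
  rw [right_split hfix, hsumE]
  refine (blockBd_add' (R := R) (H := H) 𝔬.blk 𝔬.blk hhead htail).mono fun a b => ?_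
  have hK0 : 0 ≤ N3 * B3 := mul_nonneg hN3 hB3
  have h22 : |(2 : ℝ)| = 2 := abs_two
  have ht : C * L₀ * (NF * (θ3 * g.M⁻¹)) * L₀ ^ |(2 : ℝ)| * B6.c1 d₁ δ₁ α₁ ≤
      C * L₀ * (NF * θ3) * L₀ ^ (2 : ℝ) * B6.c1 d₁ δ₁ α₁ := by
    rw [h22]
    have h3 : θ3 * g.M⁻¹ ≤ θ3 := by
      calc θ3 * g.M⁻¹ ≤ θ3 * 1 := mul_le_mul_of_nonneg_left hMinv hθ3
        _ = θ3 := mul_one _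
    have h4 : C * L₀ * (NF * (θ3 * g.M⁻¹)) ≤ C * L₀ * (NF * θ3) :=
      mul_le_mul_of_nonneg_left (mul_le_mul_of_nonneg_left h3 hNF) (mul_nonneg hC hL₀)
    exact mul_le_mul_of_nonneg_right (mul_le_mul_of_nonneg_right h4 (Real.rpow_nonneg hL₀ _)) hc1
  calc N3 * (B3 * Real.exp (-(δ₁ * g.dist a b))) +
        C * L₀ * (NF * (θ3 * g.M⁻¹)) * L₀ ^ |(2 : ℝ)| * B6.c1 d₁ δ₁ α₁ * Real.exp (-((1 - 2 * α) * δ * g.dist a b))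
      = N3 * B3 * Real.exp (-(δ₁ * g.dist a b)) +
        C * L₀ * (NF * (θ3 * g.M⁻¹)) * L₀ ^ |(2 : ℝ)| * B6.c1 d₁ δ₁ α₁ * Real.exp (-((1 - 2 * α) * δ * g.dist a b)) := by ring
    _ ≤ N3 * B3 * Real.exp (-((1 - 2 * α) * δ * g.dist a b)) +
        C * L₀ * (NF * θ3) * L₀ ^ (2 : ℝ) * B6.c1 d₁ δ₁ α₁ * Real.exp (-((1 - 2 * α) * δ * g.dist a b)) :=
        add_le_add (mul_le_mul_of_nonneg_left (hexp a b) hK0) (mul_le_mul_of_nonneg_right ht (Real.exp_nonneg _))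
    _ = secondConst d₁ δ₁ α₁ N3 B3 NF θ3 C L₀ * Real.exp (-((1 - 2 * α) * δ * g.dist a b)) := by
        unfold secondConst; ring

/-- ★ **THE FOURTH L² MEMBER OF (3.46) FOR THE SUM G(U), PER DIRECTION PAIR, BY ADJOINT TRANSFER** — ∇_{U,ν}∇_{U,μ}G = (G∇\*_{U,μ}∇\*_{U,ν})ᵀ
(G symmetric, ∇\*_κ = ∇_κᵀ: the letters `hsym`, `DirTranspose310`), and an L² block bound passes to the transpose with its arguments
swapped (r1's `B9SectDL2Decay.blockBd_of_adjoint`; the kernel e^{−ρd} is symmetric): ‖1_{Δ(y)}∇_ν∇_μGμ‖₂ ≦ `secondConst …`·e^{−(1−2α)δd}‖μ‖₂.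
[cite: Balaban1985BackgroundPropagators, (3.46) p.398 (fourth member) + p.398 ll.28–31 + p.391; Balaban1984PropagatorsII, (2.52) p.232] -/
theorem l2line3_of_local310_dir [Fintype X] [DecidableEq X] [Fintype ι] [Fintype A]
    (𝔬 : Ops310 g B X Y ι A) (𝔡 : DirOps310 𝔬 P) (𝔩 : DirLetters310 𝔬 P) (R : ℝ) (H : Prop) (d d₁ : ℕ) (δ α L₀ δ₁ α₁ ρ N N' NF Cℓ N3 B3 θ3 C : ℝ)
    (κ : Sizes310) (S3 : ι → Finset g.Site) (U : B.Cfg)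
    (hNF : 0 ≤ NF) (hN3 : 0 ≤ N3) (hB3 : 0 ≤ B3) (hθ3 : 0 ≤ θ3) (hM : 1 ≤ g.M) (hC : 0 ≤ C)
    (hα2 : 2 * α * δ ≤ δ) (hα₁δ₁ : 0 ≤ α₁ * δ₁) (hrate : (1 - 2 * α) * δ ≤ (1 - α₁) * δ₁)
    (hs : StaticOK310 𝔬 ρ N N' NF Cℓ κ) (hcnt3 : ∀ a : g.Site, (∑ i, if a ∈ S3 i then (1 : ℝ) else 0) ≤ N3)
    (h261 : Ineq261 d₁ (toB6 g R H) δ₁ α₁) (hF : Facts347 g R H d δ α L₀) (hi : Identities310₂ 𝔬 𝔡 𝔩 R H U)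
    (hL : L2SecondLegs310 𝔬 𝔡 R H S3 B3 δ₁ U) (hFL : FactorsL2Second310 𝔬 𝔡 R H θ3 δ₁ U) (hDT : DirTranspose310 𝔬 𝔡 U)
    (h0 : HasMajorant (g := toB6 g R H) 𝔬.blk (𝔬.G U) (fun (a b : g.Site) => C * g.len a ^ 2 * Real.exp (-(δ * g.dist a b))))
    (hsym : IsTransposePair (𝔬.G U) (𝔬.G U)) (ν μ : P) :
    BlockBd (g := toB6 g R H) 𝔬.blk 𝔬.blk ((𝔡.Dd U ν ∘ₗ 𝔡.Dd U μ) ∘ₗ 𝔬.G U)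
      (fun (a b : g.Site) => secondConst d₁ δ₁ α₁ N3 B3 NF θ3 C L₀ * Real.exp (-((1 - 2 * α) * δ * g.dist a b))) := by
  have h5 := l2line5_of_local310_dir 𝔬 𝔡 𝔩 R H d d₁ δ α L₀ δ₁ α₁ ρ N N' NF Cℓ N3 B3 θ3 C κ S3 U hNF hN3 hB3 hθ3 hM hC hα2 hα₁δ₁
    hrate hs hcnt3 h261 hF hi hL hFL h0 hsym μ ν
  have hL₀ : 0 ≤ L₀ := le_trans (le_trans zero_le_one hF.one_le_L) hF.L_le
  have hK : 0 ≤ secondConst d₁ δ₁ α₁ N3 B3 NF θ3 C L₀ := secondConst_nonneg hN3 hB3 hNF hθ3 hC hL₀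
  -- (G ∘ ∇*_μ ∘ ∇*_ν)ᵀ = ∇_ν ∘ ∇_μ ∘ G
  have hadj : IsTransposePair (𝔬.G U ∘ₗ (𝔡.Dsd U μ ∘ₗ 𝔡.Dsd U ν)) ((𝔡.Dd U ν ∘ₗ 𝔡.Dd U μ) ∘ₗ 𝔬.G U) :=
    ((hDT.tr ν).comp (hDT.tr μ)).comp hsym
  have h := blockBd_of_adjoint (g := toB6 g R H) (blk₁ := 𝔬.blk) (blk₂ := 𝔬.blk) (T := (𝔡.Dd U ν ∘ₗ 𝔡.Dd U μ) ∘ₗ 𝔬.G U)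
    (T' := 𝔬.G U ∘ₗ (𝔡.Dsd U μ ∘ₗ 𝔡.Dsd U ν)) (fun u w => by
      rw [dotProduct, dotProduct]
      exact (hadj u w).symm) h5 (fun y y' => mul_nonneg hK (Real.exp_nonneg _))
  refine h.mono fun y y' => ?_
  rw [hs.symm y' y]

/-- ★ **THE PACKAGED FAMILY G∇\*_{U,ν}∇\*_{U,μ} OVER THE PAIRS (ν, μ) ∈ P × P** has the L² block bound |P|·`secondConst …`·e^{−(1−2α)δd}
between the fibres of `blk` and `blk ∘ fst` (√|P × P| = |P|). [cite: Balaban1985BackgroundPropagators, (3.46) p.398 + (3.39) p.397] -/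
theorem blockBd_second_family5_dir [Fintype X] [DecidableEq X] [Fintype ι] [Fintype A]
    (𝔬 : Ops310 g B X Y ι A) (𝔡 : DirOps310 𝔬 P) (𝔩 : DirLetters310 𝔬 P) (R : ℝ) (H : Prop) (d d₁ : ℕ) (δ α L₀ δ₁ α₁ ρ N N' NF Cℓ N3 B3 θ3 C : ℝ)
    (κ : Sizes310) (S3 : ι → Finset g.Site) (U : B.Cfg)
    (hNF : 0 ≤ NF) (hN3 : 0 ≤ N3) (hB3 : 0 ≤ B3) (hθ3 : 0 ≤ θ3) (hM : 1 ≤ g.M) (hC : 0 ≤ C)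
    (hα2 : 2 * α * δ ≤ δ) (hα₁δ₁ : 0 ≤ α₁ * δ₁) (hrate : (1 - 2 * α) * δ ≤ (1 - α₁) * δ₁)
    (hs : StaticOK310 𝔬 ρ N N' NF Cℓ κ) (hcnt3 : ∀ a : g.Site, (∑ i, if a ∈ S3 i then (1 : ℝ) else 0) ≤ N3)
    (h261 : Ineq261 d₁ (toB6 g R H) δ₁ α₁) (hF : Facts347 g R H d δ α L₀) (hi : Identities310₂ 𝔬 𝔡 𝔩 R H U)
    (hL : L2SecondLegs310 𝔬 𝔡 R H S3 B3 δ₁ U) (hFL : FactorsL2Second310 𝔬 𝔡 R H θ3 δ₁ U)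
    (h0 : HasMajorant (g := toB6 g R H) 𝔬.blk (𝔬.G U) (fun (a b : g.Site) => C * g.len a ^ 2 * Real.exp (-(δ * g.dist a b))))
    (hsym : IsTransposePair (𝔬.G U) (𝔬.G U)) :
    BlockBd (g := toB6 g R H) 𝔬.blk (𝔬.blk ∘ Prod.fst)
      (familyOp fun p : P × P => 𝔬.G U ∘ₗ (𝔡.Dsd U p.1 ∘ₗ 𝔡.Dsd U p.2))
      (fun (a b : g.Site) => (Fintype.card P : ℝ) * secondConst d₁ δ₁ α₁ N3 B3 NF θ3 C L₀ *
        Real.exp (-((1 - 2 * α) * δ * g.dist a b))) := by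
  have hL₀ : 0 ≤ L₀ := le_trans (le_trans zero_le_one hF.one_le_L) hF.L_le
  have hK : 0 ≤ secondConst d₁ δ₁ α₁ N3 B3 NF θ3 C L₀ := secondConst_nonneg hN3 hB3 hNF hθ3 hC hL₀
  have h := blockBd_familyOp (R := R) (H := H) 𝔬.blk 𝔬.blk (P := P × P)
    (T := fun p : P × P => 𝔬.G U ∘ₗ (𝔡.Dsd U p.1 ∘ₗ 𝔡.Dsd U p.2))
    (fun a b => mul_nonneg hK (Real.exp_nonneg _))
    (fun p => l2line5_of_local310_dir 𝔬 𝔡 𝔩 R H d d₁ δ α L₀ δ₁ α₁ ρ N N' NF Cℓ N3 B3 θ3 C κ S3 U hNF hN3 hB3 hθ3 hM hC hα2 hα₁δ₁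
      hrate hs hcnt3 h261 hF hi hL hFL h0 hsym p.1 p.2)
  refine h.mono fun a b => le_of_eq ?_
  rw [Fintype.card_prod, Nat.cast_mul, Real.sqrt_mul_self (Nat.cast_nonneg _)]
  ring

/-- ★ **THE PACKAGED FAMILY ∇_{U,ν}∇_{U,μ}G OVER THE PAIRS (ν, μ) ∈ P × P** has the L² block bound |P|·`secondConst …`·e^{−(1−2α)δd}
between the fibres of `blk` and `blk ∘ fst`. [cite: Balaban1985BackgroundPropagators, (3.46) p.398 + (3.39) p.397] -/
theorem blockBd_second_family3_dir [Fintype X] [DecidableEq X] [Fintype ι] [Fintype A]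
    (𝔬 : Ops310 g B X Y ι A) (𝔡 : DirOps310 𝔬 P) (𝔩 : DirLetters310 𝔬 P) (R : ℝ) (H : Prop) (d d₁ : ℕ) (δ α L₀ δ₁ α₁ ρ N N' NF Cℓ N3 B3 θ3 C : ℝ)
    (κ : Sizes310) (S3 : ι → Finset g.Site) (U : B.Cfg)
    (hNF : 0 ≤ NF) (hN3 : 0 ≤ N3) (hB3 : 0 ≤ B3) (hθ3 : 0 ≤ θ3) (hM : 1 ≤ g.M) (hC : 0 ≤ C)
    (hα2 : 2 * α * δ ≤ δ) (hα₁δ₁ : 0 ≤ α₁ * δ₁) (hrate : (1 - 2 * α) * δ ≤ (1 - α₁) * δ₁)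
    (hs : StaticOK310 𝔬 ρ N N' NF Cℓ κ) (hcnt3 : ∀ a : g.Site, (∑ i, if a ∈ S3 i then (1 : ℝ) else 0) ≤ N3)
    (h261 : Ineq261 d₁ (toB6 g R H) δ₁ α₁) (hF : Facts347 g R H d δ α L₀) (hi : Identities310₂ 𝔬 𝔡 𝔩 R H U)
    (hL : L2SecondLegs310 𝔬 𝔡 R H S3 B3 δ₁ U) (hFL : FactorsL2Second310 𝔬 𝔡 R H θ3 δ₁ U) (hDT : DirTranspose310 𝔬 𝔡 U)
    (h0 : HasMajorant (g := toB6 g R H) 𝔬.blk (𝔬.G U) (fun (a b : g.Site) => C * g.len a ^ 2 * Real.exp (-(δ * g.dist a b))))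
    (hsym : IsTransposePair (𝔬.G U) (𝔬.G U)) :
    BlockBd (g := toB6 g R H) 𝔬.blk (𝔬.blk ∘ Prod.fst)
      (familyOp fun p : P × P => (𝔡.Dd U p.1 ∘ₗ 𝔡.Dd U p.2) ∘ₗ 𝔬.G U)
      (fun (a b : g.Site) => (Fintype.card P : ℝ) * secondConst d₁ δ₁ α₁ N3 B3 NF θ3 C L₀ *
        Real.exp (-((1 - 2 * α) * δ * g.dist a b))) := by
  have hL₀ : 0 ≤ L₀ := le_trans (le_trans zero_le_one hF.one_le_L) hF.L_le
  have hK : 0 ≤ secondConst d₁ δ₁ α₁ N3 B3 NF θ3 C L₀ := secondConst_nonneg hN3 hB3 hNF hθ3 hC hL₀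
  have h := blockBd_familyOp (R := R) (H := H) 𝔬.blk 𝔬.blk (P := P × P)
    (T := fun p : P × P => (𝔡.Dd U p.1 ∘ₗ 𝔡.Dd U p.2) ∘ₗ 𝔬.G U)
    (fun a b => mul_nonneg hK (Real.exp_nonneg _))
    (fun p => l2line3_of_local310_dir 𝔬 𝔡 𝔩 R H d d₁ δ α L₀ δ₁ α₁ ρ N N' NF Cℓ N3 B3 θ3 C κ S3 U hNF hN3 hB3 hθ3 hM hC hα2 hα₁δ₁
      hrate hs hcnt3 h261 hF hi hL hFL hDT h0 hsym p.1 p.2)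
  refine h.mono fun a b => le_of_eq ?_
  rw [Fintype.card_prod, Nat.cast_mul, Real.sqrt_mul_self (Nat.cast_nonneg _)]
  ring

end GSide

end

end Literature.MathematicalPhysics.QuantumFieldTheory.Balaban1983to89.B9RWSums346SecondDiffDir
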